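import Literature.Computability.QuantumComplexity.GluedTreesProofs

/-!
# Theorem 3 of ChildsEtAl2003 for a DISCRETE time average (the form a circuit family can use)

Helper for the support item `WbwSuccinctWalk` (stmt-QuantumAdvantage-2360) of route
`Summits/QuantumAdvantage/QuantumAdvantage/Theses/WhiteBoxWalk` (clause (Q) of `WbwThesis` for the
glued-trees witness). The tree's `ChildsEtAl2003_thm3` averages `|⟨EXIT| e^{-iHt} |ENTRANCE⟩|²` over
`t` uniform in the INTERVAL `[0, τ]`; a quantum circuit cannot sample a continuous time: it holds a
uniform superposition over a register `m < M` and applies the controlled evolutions `e^{-iH·mτ/M}`,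
so that the final measurement sees the average over the GRID `{mτ/M : m < M}`. This file proves
Theorem 3 in that form, reusing the tree's spectral data (`GluedTrees.Thm3`: `exitAmplitude_eq`,
`sum_abs_coef`, `sum_coef_sq`, `Ev_sep`, `xh_spec`):

* `abs_sum_cos_mul_le` — Lagrange: `|Σ_{m<M} cos (m x)| ≤ π/|x|` for `0 < |x| ≤ π`
  (telescoping `2 sin(x/2) cos(mx) = sin((m+½)x) − sin((m−½)x)` and Jordan's inequality);
* `sum_norm_sq_lower` — the grid analogue of the tree's `integral_norm_sq_lower` (Lemma 1, real
  form): `Σ_{m<M} ‖Σ_k c_k e^{-i m h E_k}‖² ≥ M Σ_k c_k² − π (Σ_k |c_k|)² / (h δ)` when distinct `E_k`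
  are `δ`-separated and all differences are `≤ Ω` with `h Ω ≤ π`;
* `abs_Ev_le` — the walk eigenvalues satisfy `|E_k| ≤ 5/2` (`x_k ∈ [-x_h, x_h]`, `x_h ≤ 5/4`), so
  `|E_k − E_k'| ≤ 5`;
* `discreteTimeAverage_exit` — **Theorem 3, grid form**: for `ε > 0`, `n ≥ 8`, every cycle datum
  `σ`, every `τ ≥ π (n+1)⁴/(2ε)` and every `M ≥ 5τ/π`,
  `(1/M) Σ_{m<M} |⟨EXIT| e^{-iH mτ/M} |ENTRANCE⟩|² > (1 − ε)/(2(n+1))`.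
[cite: ChildsEtAl2003, Theorem 3, Lemma 1, Lemma 2 (§3.4), arXiv:quant-ph/0209131]
-/

noncomputable section

namespace Summit.QuantumAdvantage.QuantumAdvantage.Theorems.WbwSuccinctWalk

open Real Literature.Computability.QuantumComplexity GluedTrees GluedTrees.Thm3

/-! ## Lagrange's bound for cosine sums on a grid -/

/-- Telescoping identity `2 sin(x/2) Σ_{m<M} cos(m x) = sin((M − ½) x) + sin(x/2)`. [folklore] -/
theorem two_mul_sin_half_mul_sum_cos (x : ℝ) (M : ℕ) :
    2 * sin (x / 2) * ∑ m ∈ Finset.range M, cos (m * x) = sin ((M - 1 / 2) * x) + sin (x / 2) := by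
  induction M with
  | zero =>
    simp only [Finset.range_zero, Finset.sum_empty, mul_zero, CharP.cast_eq_zero, zero_sub]
    rw [show -(1 / 2 : ℝ) * x = -(x / 2) by ring, sin_neg]
    ring
  | succ M ih =>
    rw [Finset.sum_range_succ, mul_add, ih, two_mul_sin_mul_cos]
    push_cast
    rw [show x / 2 - M * x = -((M - 1 / 2) * x) by ring, sin_neg,
      show x / 2 + M * x = (M + 1 - 1 / 2) * x by ring]
    ring

/-- **Lagrange's bound**: `|Σ_{m<M} cos (m x)| ≤ π / |x|` for `0 < |x| ≤ π` (via
`|Σ| ≤ 1/|sin(x/2)|` and Jordan's inequality `sin y ≥ (2/π) y` on `[0, π/2]`). [folklore] -/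
theorem abs_sum_cos_mul_le {x : ℝ} (hx0 : x ≠ 0) (hxπ : |x| ≤ π) (M : ℕ) :
    |∑ m ∈ Finset.range M, cos (m * x)| ≤ π / |x| := by
  -- Jordan: |sin (x/2)| ≥ |x|/π
  have hsin : |x| / π ≤ |sin (x / 2)| := by
    have h1 : 0 ≤ |x| / 2 := by positivity
    have h2 : |x| / 2 ≤ π / 2 := by linarith
    have hj := Real.mul_le_sin h1 h2
    have e : |sin (x / 2)| = sin (|x| / 2) := by
      rcases le_or_gt 0 x with hx | hx
      · rw [abs_of_nonneg hx, abs_of_nonneg]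
        exact sin_nonneg_of_nonneg_of_le_pi (by linarith) (by linarith [abs_of_nonneg hx ▸ hxπ])
      · rw [abs_of_neg hx, show -x / 2 = -(x / 2) by ring, sin_neg, abs_of_nonpos]
        have : sin (-(x / 2)) ≥ 0 :=
          sin_nonneg_of_nonneg_of_le_pi (by linarith) (by linarith [abs_of_neg hx ▸ hxπ])
        rw [sin_neg] at this
        linarith
    rw [e]
    calc |x| / π = 2 / π * (|x| / 2) := by ring
      _ ≤ sin (|x| / 2) := hj
  have hxpos : 0 < |x| := abs_pos.2 hx0
  have hsinpos : 0 < |sin (x / 2)| := lt_of_lt_of_le (by positivity) hsin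
  have key := two_mul_sin_half_mul_sum_cos x M
  have hb : |2 * sin (x / 2) * ∑ m ∈ Finset.range M, cos (m * x)| ≤ 2 := by
    rw [key]
    calc |sin ((M - 1 / 2) * x) + sin (x / 2)| ≤ |sin ((M - 1 / 2) * x)| + |sin (x / 2)| := abs_add_le _ _
      _ ≤ 1 + 1 := add_le_add (abs_sin_le_one _) (abs_sin_le_one _)
      _ = 2 := by norm_num
  rw [abs_mul, abs_mul, abs_two] at hb
  have h3 : |∑ m ∈ Finset.range M, cos (m * x)| ≤ 1 / |sin (x / 2)| := by
    rw [le_div_iff₀ hsinpos]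
    nlinarith
  calc |∑ m ∈ Finset.range M, cos (m * x)| ≤ 1 / |sin (x / 2)| := h3
    _ ≤ 1 / (|x| / π) := one_div_le_one_div_of_le (by positivity) hsin
    _ = π / |x| := by rw [one_div_div]

/-! ## The grid analogue of Lemma 1 (real form) -/

variable {ι : Type*} [Fintype ι]

/-- **Lower bound for the grid average** (discrete companion of the tree's
`integral_norm_sq_lower`): if distinct frequencies are `δ`-separated, all differences are `≤ Ω`, and
the grid step `h > 0` has `h Ω ≤ π`, then
`Σ_{m<M} ‖Σ_k c_k e^{-i m h E_k}‖² ≥ M Σ_k c_k² − π (Σ_k |c_k|)² / (h δ)`.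
[cite: ChildsEtAl2003, Lemma 1] -/
theorem sum_norm_sq_lower [DecidableEq ι] (c E : ι → ℝ) {δ Ω h : ℝ} (M : ℕ) (hδ : 0 < δ)
    (hh : 0 < h) (hsep : ∀ k k', k ≠ k' → δ ≤ |E k - E k'|) (hbd : ∀ k k', |E k - E k'| ≤ Ω)
    (hgrid : h * Ω ≤ π) :
    M * ∑ k, c k ^ 2 - π * (∑ k, |c k|) ^ 2 / (h * δ) ≤
      ∑ m ∈ Finset.range M,
        ‖∑ k, (c k : ℂ) * Complex.exp ((-((m * h) * E k) : ℝ) * Complex.I)‖ ^ 2 := by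
  simp_rw [norm_sq_sum_exp]
  rw [Finset.sum_comm]
  rw [Finset.sum_congr rfl (fun k _ ↦ Finset.sum_comm)]
  -- now: Σ_k Σ_k' Σ_m c_k c_k' cos (m h (E_k − E_k'))
  have hterm : ∀ k k', (if k = k' then (M : ℝ) * c k ^ 2 else -(π * (|c k| * |c k'|) / (h * δ))) ≤
      ∑ m ∈ Finset.range M, c k * c k' * cos (m * h * (E k - E k')) := by
    intro k k'
    by_cases hk : k = k'
    · subst hk
      rw [if_pos rfl]
      simp only [sub_self, mul_zero, cos_zero, mul_one, Finset.sum_const, Finset.card_range,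
        nsmul_eq_mul]
      nlinarith
    · rw [if_neg hk, ← Finset.mul_sum]
      have hω : E k - E k' ≠ 0 := by
        intro e
        have := hsep k k' hk
        rw [e, abs_zero] at this
        linarith
      have hx0 : h * (E k - E k') ≠ 0 := mul_ne_zero hh.ne' hω
      have hxπ : |h * (E k - E k')| ≤ π := by
        rw [abs_mul, abs_of_pos hh]
        exact (mul_le_mul_of_nonneg_left (hbd k k') hh.le).trans hgrid
      have hL := abs_sum_cos_mul_le hx0 hxπ M
      have e : ∑ m ∈ Finset.range M, cos (m * h * (E k - E k')) =
          ∑ m ∈ Finset.range M, cos (m * (h * (E k - E k'))) :=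
        Finset.sum_congr rfl fun m _ ↦ by rw [mul_assoc]
      rw [e]
      have h1 : |c k * c k' * ∑ m ∈ Finset.range M, cos (m * (h * (E k - E k')))| ≤
          π * (|c k| * |c k'|) / (h * δ) := by
        rw [abs_mul, abs_mul]
        calc |c k| * |c k'| * |∑ m ∈ Finset.range M, cos (m * (h * (E k - E k')))|
            ≤ |c k| * |c k'| * (π / |h * (E k - E k')|) :=
              mul_le_mul_of_nonneg_left hL (by positivity)
          _ ≤ |c k| * |c k'| * (π / (h * δ)) := by
              apply mul_le_mul_of_nonneg_left _ (by positivity)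
              rw [abs_mul, abs_of_pos hh]
              exact div_le_div_of_nonneg_left pi_pos.le (by positivity)
                (mul_le_mul_of_nonneg_left (hsep k k' hk) hh.le)
          _ = π * (|c k| * |c k'|) / (h * δ) := by ring
      linarith [neg_abs_le (c k * c k' * ∑ m ∈ Finset.range M, cos (m * (h * (E k - E k'))))]
  have hsum : (M : ℝ) * ∑ k, c k ^ 2 - π * (∑ k, |c k|) ^ 2 / (h * δ) ≤
      ∑ k, ∑ k', (if k = k' then (M : ℝ) * c k ^ 2 else -(π * (|c k| * |c k'|) / (h * δ))) := by
    have e : ∀ k, ∑ k', (if k = k' then (M : ℝ) * c k ^ 2 else -(π * (|c k| * |c k'|) / (h * δ))) =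
        M * c k ^ 2 - ∑ k' ∈ Finset.univ.erase k, π * (|c k| * |c k'|) / (h * δ) := by
      intro k
      rw [← Finset.add_sum_erase _ _ (Finset.mem_univ k), if_pos rfl, sub_eq_add_neg,
        ← Finset.sum_neg_distrib]
      congr 1
      exact Finset.sum_congr rfl fun k' hk' ↦ if_neg (Finset.ne_of_mem_erase hk').symm
    simp_rw [e]
    rw [Finset.sum_sub_distrib, ← Finset.mul_sum]
    have hB : ∑ k, ∑ k' ∈ Finset.univ.erase k, π * (|c k| * |c k'|) / (h * δ) ≤
        π * (∑ k, |c k|) ^ 2 / (h * δ) := by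
      calc ∑ k, ∑ k' ∈ Finset.univ.erase k, π * (|c k| * |c k'|) / (h * δ)
          ≤ ∑ k, ∑ k', π * (|c k| * |c k'|) / (h * δ) :=
            Finset.sum_le_sum fun k _ ↦ Finset.sum_le_univ_sum_of_nonneg fun k' ↦ by positivity
        _ = π * (∑ k, |c k|) ^ 2 / (h * δ) := by
            rw [sq, Finset.sum_mul_sum, Finset.mul_sum, Finset.sum_div]
            refine Finset.sum_congr rfl fun k _ ↦ ?_
            rw [Finset.mul_sum, Finset.sum_div]
    linarith
  exact hsum.trans (Finset.sum_le_sum fun k _ ↦ Finset.sum_le_sum fun k' _ ↦ hterm k k')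

/-! ## The walk eigenvalues are bounded by `5/2` -/

variable {n : ℕ}

/-- `|x_k| ≤ 5/4` for `n ≥ 2` (`x_k ∈ {x_h, cos q_r, −x_h}`, `1 ≤ x_h ≤ 5/4`). [cite: ChildsEtAl2003, §3.4] -/
theorem abs_xs_le (hn : 2 ≤ n) (k : K n) : |xs n k| ≤ 5 / 4 := by
  obtain ⟨h1, h2, -⟩ := xh_spec hn
  unfold xs g
  split_ifs
  · rw [abs_of_nonneg (by linarith)]; exact h2
  · exact (abs_cos_le_one _).trans (by norm_num)
  · rw [abs_neg, abs_of_nonneg (by linarith)]; exact h2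

/-- `|E_k| ≤ 5/2` for `n ≥ 2`. [cite: ChildsEtAl2003, §3.4] -/
theorem abs_Ev_le (hn : 2 ≤ n) (k : K n) : |Ev n k| ≤ 5 / 2 := by
  rw [Ev, abs_mul, abs_two]
  linarith [abs_xs_le hn k]

/-- Eigenvalue differences are at most `5` (`n ≥ 2`). [cite: ChildsEtAl2003, §3.4] -/
theorem abs_Ev_sub_Ev_le (hn : 2 ≤ n) (k k' : K n) : |Ev n k - Ev n k'| ≤ 5 := by
  calc |Ev n k - Ev n k'| ≤ |Ev n k| + |Ev n k'| := abs_sub _ _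
    _ ≤ 5 / 2 + 5 / 2 := add_le_add (abs_Ev_le hn k) (abs_Ev_le hn k')
    _ = 5 := by norm_num

/-! ## Theorem 3, grid form -/

/-- **Theorem 3 of ChildsEtAl2003 for the grid average.** For `ε > 0`, `n ≥ 8`, every cycle datum
`σ`, every horizon `τ ≥ π (n+1)⁴/(2ε)` and every grid size `M ≥ 5τ/π`, the average over the grid
`t_m = mτ/M` (`m < M`) of the EXIT probability `|⟨EXIT| e^{-iH t_m} |ENTRANCE⟩|²` of the walk on
`G'_n(σ)` exceeds `(1 − ε)/(2(n+1))`. (Same proof as the tree's `ChildsEtAl2003_thm3_holds` —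
spectral expansion, `ΔE ≥ 6/(n+1)³`, Cauchy–Schwarz `Σ c_k² ≥ 1/(2(n+1))` — with Lemma 1's time
integral replaced by Lagrange's bound on the grid; the grid condition `(τ/M)·5 ≤ π` keeps every
phase step below `π`.) [cite: ChildsEtAl2003, Theorem 3, Lemma 1, Lemma 2 (§3.4)] -/
theorem discreteTimeAverage_exit {ε : ℝ} (hε : 0 < ε) (hn : 8 ≤ n) (σ : CycleDatum n) {τ : ℝ}
    (hτ : π * ((n : ℝ) + 1) ^ 4 / (2 * ε) ≤ τ) {M : ℕ} (hM : 5 * τ / π ≤ M) :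
    (1 - ε) / (2 * ((n : ℝ) + 1)) <
      (M : ℝ)⁻¹ * ∑ m ∈ Finset.range M, ‖exitAmplitude n σ (m * (τ / M))‖ ^ 2 := by
  have hN : (0 : ℝ) < (n : ℝ) + 1 := by positivity
  have hτ0 : 0 < τ := lt_of_lt_of_le (by positivity) hτ
  have hM0 : (0 : ℝ) < M := lt_of_lt_of_le (by positivity) hM
  set h : ℝ := τ / M with hh
  have hh0 : 0 < h := div_pos hτ0 hM0
  have hamp : ∀ m : ℕ, ‖exitAmplitude n σ (m * h)‖ ^ 2 =
      ‖∑ k : K n, (coef n k : ℂ) * Complex.exp ((-((m * h) * Ev n k) : ℝ) * Complex.I)‖ ^ 2 := by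
    intro m; rw [exitAmplitude_eq hn]
  simp_rw [hamp]
  have hδ : (0 : ℝ) < 6 / ((n : ℝ) + 1) ^ 3 := by positivity
  have hgrid : h * 5 ≤ π := by
    rw [hh, div_mul_eq_mul_div, div_le_iff₀ hM0]
    rw [div_le_iff₀ pi_pos] at hM
    linarith
  have hlow := sum_norm_sq_lower (coef n) (Ev n) M hδ hh0 (fun k k' hk ↦ Ev_sep hn k k' hk)
    (fun k k' ↦ abs_Ev_sub_Ev_le (by omega) k k') hgrid
  rw [sum_abs_coef hn, one_pow, mul_one] at hlow
  have hcs := sum_coef_sq hn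
  -- the error term: π / (h δ) = π (n+1)³ M / (6 τ) ≤ M ε / (3 (n+1))
  have herr : π / (h * (6 / ((n : ℝ) + 1) ^ 3)) ≤ M * (ε / (3 * ((n : ℝ) + 1))) := by
    rw [hh, div_le_iff₀ (by positivity)]
    -- goal: π ≤ M * (ε / (3 (n+1))) * (τ / M * (6 / (n+1)^3))
    have e : (M : ℝ) * (ε / (3 * ((n : ℝ) + 1))) * (τ / M * (6 / ((n : ℝ) + 1) ^ 3)) =
        τ * (2 * ε) / ((n : ℝ) + 1) ^ 4 := by
      field_simp
      ring
    rw [e, le_div_iff₀ (by positivity)]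
    rw [div_le_iff₀ (by positivity)] at hτ
    linarith
  rw [inv_mul_eq_div, lt_div_iff₀ hM0]
  have h1 : (1 - ε) / (2 * ((n : ℝ) + 1)) < 1 / (2 * ((n : ℝ) + 1)) - ε / (3 * ((n : ℝ) + 1)) := by
    rw [div_sub_div _ _ (by positivity) (by positivity), div_lt_div_iff₀ (by positivity) (by positivity)]
    nlinarith [mul_pos (mul_pos hN hN) hε]
  calc (1 - ε) / (2 * ((n : ℝ) + 1)) * M
      < (∑ k : K n, coef n k ^ 2 - ε / (3 * ((n : ℝ) + 1))) * M := by
        apply mul_lt_mul_of_pos_right _ hM0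
        linarith
    _ = (M : ℝ) * ∑ k : K n, coef n k ^ 2 - M * (ε / (3 * ((n : ℝ) + 1))) := by ring
    _ ≤ (M : ℝ) * ∑ k : K n, coef n k ^ 2 - π / (h * (6 / ((n : ℝ) + 1) ^ 3)) := by linarith
    _ ≤ _ := hlow

end Summit.QuantumAdvantage.QuantumAdvantage.Theorems.WbwSuccinctWalk

end
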